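import Literature.MathematicalPhysics.QuantumFieldTheory.Balaban1983to89.Node00.TorusCoverLandau153RecTowerDoor

/-!
# NODE 00 — THE R7 DOOR, STAGE 2 AT THE CANONICAL WINDOWS `X := □₀`, `X_t := □`, `X′ := □̃`, `t := ctrShift L k·𝟙`: this lineage's g8 `exists_localGauge152_tower_member` FOR THE RECORD
# (DENTED datum `Node00.CubeB8DZ`, top-anchored lift), with the torus sets delivered as `π '' cube …` ∕ `π '' box …` of the SAME datum — the shape of N07's `HThm4Rec` rows

Cell `pub-ymgap`, width seat `pub-ymgap-dag-n07-w3` g10 (N05-REC R7 pen; LEAD PEN dag-n05-e).  NEW leaf, THEOREMS ONLY.  CONSUMED BY NAME, nothing modified: STAGE 2 (`Node00.TorusCoverLandau153RecTowerDoor`),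
the (T2) dictionary `B8Eq131CubesRecDictionary` (`image_add_ctrShift_boxZ ∕ cubeZ ∕ tcubeZ`, `mem_cubeZ_iff_add_ctrShift`, `mem_boxZ_iff_add_ctrShift`), this lineage's g7∕g8 step-closure rows
`add_e_mem_sq_zero_of_shift_mem_image_of_injOn_tcube` (`Node00.TorusCoverLandau153TowerDoor`), `add_e_mem_box_of_shift_mem_image_of_injOn ∕ sub_e_mem_box_of_unshift_mem_image_of_injOn`
(`Node00.TorusCoverLandau153Box`) READ AT AN ENGINE CUBE `CubeB8.ofUniv` WITH THE SAME NUMBERS (their proofs use only the geometry of `□₀ ∕ □ ∕ □̃`, never the ambient family), dag-n05-d's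
`B8Eq131CubesRec` inclusions.  `--kind proof --supports stmt-QuantumFields-20541` (K0⁷; count-neutral).  [6] = [Balaban1985RegularSpaces]; [15] = [Balaban1985Variational]; [I] = [Balaban1987RG1].

WHAT IS PROVED (kernel; `P : Params`, `N ≥ 1`, `d ≥ 2`; no definition; `t := fun _ => (ctrShift L k : ℤ)` throughout).
* §0 the translated windows: `image_coverShift_cubeZ ∕ image_coverShift_boxZ ∕ image_coverShift_tcubeZ` (`(x ↦ π(x + t)) '' cubeZ … j = π '' cube … j`, …), `injOn_cover_tcube_of_width` (`□̃` does not wrap when `(M + 4ρ)Lᵏ ≤ sitesPerDir 0`), `injOn_coverShift_tcubeZ`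
  (non-wrapping of `□̃` on the torus ⇒ `x ↦ π(x + t)` injective on `tcubeZ`), ★ `CubeB8DZ.add_e_mem_sq_zero_of_shift_mem_image` (forward unit steps seen on the torus lift into `Ω′₀ = □₀`),
  ★ `CubeB8DZ.add_e_mem_boxZ_of_shift_mem_image ∕ sub_e_mem_boxZ_of_unshift_mem_image` (the same for the top box, both directions).
* §1 ★★★ `exists_localGauge152_recTower_member`: for a record datum `c : CubeB8DZ` of scale `c.k = n`, a torus field `U`, the `SU(N)`-valued ∃-body of the RECORD crown at the top-anchored
  lift `V x μ = ιSU (U ⟨π(x + t), μ⟩)`, the non-wrapping `InjOn π (tcube L a M ρ k)` of the (engine-coordinate) `□̃` and `4·(N r) < 2π`: a torus gauge `u`, a potential `A` and the member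
  witness `u_m` with — (1) the gauge equation on the bonds of `regionOfSet (π '' cube L a M ρ k 0)` (`= π(□₀)`); (2) the level-weighted letters `‖A ⟨π(x+t), μ⟩‖ ≤ 2·(r·(Lʲη_n)⁻¹)` for
  `x, x + e_μ ∈ Ω′_j`, `j ≤ k`; (3)–(6) the four top letters on `π '' box L a M k` as `2rL ∕ 2rL² ∕ 2rL³ ∕ 2rL³` (the dent's level `k − 1`); (7) `A ⟨π(x+t), μ⟩ = logCfg η_n (U″^{u_m⁻¹}) x μ`
  on `tcubeZ` and the RECORD's (153); (8) ★ `ιSU (u (π(x+t))) = (u_m x)⁻¹·v_fix x` on `Ω′₀`; (9) `u_m ∈ SU(N)`, `= 1` off `Ω′₀`, ★ RECORD (1.29) `Restr129Z … u_m`, RECORD (1.137).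
HONEST FRAMING: count-neutral push-down bookkeeping over a HYPOTHESIS (the record crown body, R6's to conclude); the non-wrapping of `□̃` is DISPLAYED; nothing of [15] ∕ [6] ∕ [I]
analysis asserted; `HThm4Rec` UNDISCHARGED (caveat (C-S3-1)); N07 ∕ N05 NOT discharged; counts unmoved; one finite 𝕋⁴ programme at fixed ε — R4 closes the conditional finite-𝕋⁴ rung
`BalabanLadder.UV` only; the YM mass gap (Clay) is NOT proved by any of this; nothing continuum ∕ ℝ⁴ ∕ OS.  No `sorry`, no `def`, no `instance`, no `notation`.

References: [15] (144)–(153) pp.300–301; [6] Prop. 6 (1.135)–(1.138) p.99, (1.29) p.81, (1.131) p.99, p.98; [3] = [Balaban1985Averaging] (78)–(81) p.30; [I] (0.1) p.251, (0.3)–(0.4) pp.252–253.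
-/

noncomputable section

namespace Literature.MathematicalPhysics.QuantumFieldTheory.Balaban1983to89.Node00

open scoped Matrix.Norms.L2Operator
open B7Prop1Explicit (e e_apply gaugeAct)
open B7Prop1Local (InBox AgreeOn)
open B7Prop2Explicit (unitaryUnits mem_unitaryUnits)
open B7Prop2SpecialUnitary (specialUnitaryUnits mem_specialUnitaryUnits)
open BlockAveragingZd (avgIterZ ctrShift)
open B8Ineq132 (covDerivFwd covDeriv BondTouches)
open B8Eq131Cubes (box cube tcube tLo tHi ctr gs)
open B8Eq131CubesRec (boxZ cubeZ tcubeZ bLoZ bHiZ)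
open B8Eq131CubesRecDictionary (image_add_ctrShift_boxZ image_add_ctrShift_cubeZ image_add_ctrShift_tcubeZ mem_cubeZ_iff_add_ctrShift mem_boxZ_iff_add_ctrShift
  mem_tcubeZ_iff_add_ctrShift)
open B8Eq140Level (SideTouches)
open B8Eq138LandauZd (logCfg covDivB covLap)
open B8Eq138LandauZdRec (IsLandau138Z IsLandau138WZ)
open B8Eq119TwistedAxialRec (Restr129Z)
open B7SectEFLinearisationRec (logCovIterZ)
open B8Eq184Proof (cfgExp)
open B8LeafModelZd3 (mlogCfg)
open B8ScaledSupNorm (msup Bdd bondNorm)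
open B8Eq146AExpansion (plaqCovDeriv iEta)
open B8Eq143PlaqExpansion (pdiv)
open MatrixLog (mlog)
open B15Eq112TorusCover (cover)
open B14DomainGeom (Pt)
open B12RegularSpaces111 (gaugeU expI grad)

variable {P : Params} {N : ℕ} [NeZero N]

/-! ## §0  The canonical windows through `x ↦ π(x + ctrShift L k·𝟙)` -/

section Windows

omit [NeZero N] in
/-- `(x ↦ π(x + c_k·𝟙)) '' □_jᶻ = π '' □_j` (`j ≤ k`): the torus set of the record's centred cube IS the torus set of the engine cube of the same datum.
[cite: Balaban1987RG1, (0.3) p.252, (0.1) p.251; Balaban1985RegularSpaces, p.98] -/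
theorem image_coverShift_cubeZ (a : Pt P.d) (M ρ : ℕ) {k j : ℕ} (hj : j ≤ k) :
    (fun x => cover P (x + fun _ => (ctrShift P.L k : ℤ))) '' cubeZ P.L a M ρ k j = cover P '' cube P.L a M ρ k j := by
  rw [← image_add_ctrShift_cubeZ P.hL.1 a M ρ hj, Set.image_image]

omit [NeZero N] in
/-- `(x ↦ π(x + c_k·𝟙)) '' □ᶻ = π '' □`. [cite: Balaban1987RG1, (0.3) p.252, (0.1) p.251; Balaban1985RegularSpaces, p.98] -/
theorem image_coverShift_boxZ (a : Pt P.d) (M k : ℕ) :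
    (fun x => cover P (x + fun _ => (ctrShift P.L k : ℤ))) '' boxZ P.L a M k = cover P '' box P.L a M k := by
  rw [← image_add_ctrShift_boxZ P.L a M k, Set.image_image]

omit [NeZero N] in
/-- `(x ↦ π(x + c_k·𝟙)) '' □̃ᶻ = π '' □̃`. [cite: Balaban1987RG1, (0.3) p.252, (0.1) p.251; Balaban1985RegularSpaces, p.98] -/
theorem image_coverShift_tcubeZ (a : Pt P.d) (M ρ k : ℕ) :
    (fun x => cover P (x + fun _ => (ctrShift P.L k : ℤ))) '' tcubeZ P.L a M ρ k = cover P '' tcube P.L a M ρ k := by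
  rw [← image_add_ctrShift_tcubeZ P.hL.1 a M ρ k, Set.image_image]

omit [NeZero N] in
/-- ★ **NON-WRAPPING OF `□̃` LIFTS TO THE TRANSLATED COVER**: if `π` is injective on the engine `□̃`, then `x ↦ π(x + c_k·𝟙)` is injective on the record's `□̃ᶻ`.
[cite: Balaban1987RG1, (0.1) p.251, (0.3) p.252; Balaban1985RegularSpaces, p.98] -/
theorem injOn_coverShift_tcubeZ {a : Pt P.d} {M ρ k : ℕ} (hinj : Set.InjOn (cover P) (tcube P.L a M ρ k)) :
    Set.InjOn (fun x => cover P (x + fun _ => (ctrShift P.L k : ℤ))) (tcubeZ P.L a M ρ k) := by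
  intro x hx y hy hxy
  have hx' := (mem_tcubeZ_iff_add_ctrShift P.hL.1 a M ρ k x).1 hx
  have hy' := (mem_tcubeZ_iff_add_ctrShift P.hL.1 a M ρ k y).1 hy
  exact add_right_cancel (hinj hx' hy' hxy)

omit [NeZero N] in
/-- ★ **THE COLLARED CUBE `□̃` DOES NOT WRAP when its fine side fits in the torus**: `(M + 4ρ)·Lᵏ ≤ sitesPerDir 0` ⇒ `π` injective on `tcube L a M ρ k` (k0-s1-w3's
`injOn_cover_cube_zero` for `□̃` instead of `□₀`; the knit feeds it from `Mc + 11d + 6ρ ≤ sitesPerDir k`, `sideP ≤ Mc + 11d + 2ρ`). [cite: Balaban1985RegularSpaces, p.98 («□̃»); Balaban1987RG1, (0.1) p.251] -/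
theorem injOn_cover_tcube_of_width {a : Pt P.d} {M ρ k : ℕ} (hw : (M + 4 * ρ) * P.L ^ k ≤ P.sitesPerDir 0) :
    Set.InjOn (cover P) (tcube P.L a M ρ k) := by
  have hwid : ∀ i, B8Ineq130.thi P.L (tHi a M ρ) k i - B8Ineq130.tlo P.L (tLo a ρ) k i + 1 ≤ P.sitesPerDir 0 := by
    intro i
    rw [B8Ineq130.thi_apply, B8Ineq130.tlo_apply]
    simp only [tHi, tLo]
    have hw' : (((M + 4 * ρ) * P.L ^ k : ℕ) : ℤ) ≤ ((P.sitesPerDir 0 : ℕ) : ℤ) := by exact_mod_cast hw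
    have hring : (P.L : ℤ) ^ k * (a i + M - 1 + 2 * ρ + 1) - 1 - (P.L : ℤ) ^ k * (a i - 2 * ρ) + 1 = (M + 4 * ρ) * (P.L : ℤ) ^ k := by ring
    push_cast at hw' ⊢
    linarith [hring, hw']
  intro x hx x' hx' h
  exact Sect2.eq_of_cover_eq_of_inBox hwid hx hx' h

variable {K' : ℕ} {Ω' : ℕ → Set (B7Prop1Explicit.Site P.d)} (c : CubeB8DZ P.d P.L K' Ω')

omit [NeZero N] in
/-- ★ **FORWARD UNIT STEPS SEEN ON THE TORUS LIFT INTO `Ω′₀ = □₀`** (record datum, top-anchored lift): `x ∈ □₀ᶻ`, `π(x + c_k) + e_μ ∈ π(□₀ᶻ + c_k)` ⇒ `x + e_μ ∈ □₀ᶻ` — this lineage's g7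
`add_e_mem_sq_zero_of_shift_mem_image_of_injOn_tcube` read at the engine cube `CubeB8.ofUniv` of the same numbers, through the (T2) dictionary.
[cite: Balaban1985RegularSpaces, p.98, (1.131) p.99; Balaban1987RG1, (0.1) p.251, (0.3) p.252] -/
theorem CubeB8DZ.add_e_mem_sq_zero_of_shift_mem_image (hinj : Set.InjOn (cover P) (tcube P.L c.a c.M c.ρ c.k)) {x : Pt P.d} (hx : x ∈ c.sq 0) {μ : Fin P.d}
    (h : (cover P (x + fun _ => (ctrShift P.L c.k : ℤ))).shift μ ∈ (fun x => cover P (x + fun _ => (ctrShift P.L c.k : ℤ))) '' c.sq 0) : x + e μ ∈ c.sq 0 := by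
  have hLo : Odd P.L := P.hL.1
  set c' : CubeB8 P.d P.L c.k (fun _ => (Set.univ : Set (B7Prop1Explicit.Site P.d))) :=
    CubeB8.ofUniv c.k c.a c.M c.ρ c.one_le_k le_rfl c.L_le_ρ c.ρ_le_M c.big c.L_le_dM rfl rfl with hc'
  have h0' : c'.sq 0 = cube P.L c.a c.M c.ρ c.k 0 := B8Eq131CubesAdmissible.cubeFam_false_zero P.L c.a c.M c.ρ c.k
  have h0 : ∀ y, y ∈ c.sq 0 ↔ (y + fun _ => (ctrShift P.L c.k : ℤ)) ∈ c'.sq 0 := fun y => by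
    rw [c.sq_zero, h0']; exact mem_cubeZ_iff_add_ctrShift hLo c.a c.M c.ρ (Nat.zero_le _) y
  rw [h0]
  have hx' := (h0 x).1 hx
  obtain ⟨x₁, hx₁, hc₁⟩ := h
  have hmem : (cover P (x + fun _ => (ctrShift P.L c.k : ℤ))).shift μ ∈ cover P '' c'.sq 0 := ⟨x₁ + fun _ => (ctrShift P.L c.k : ℤ), (h0 x₁).1 hx₁, hc₁⟩
  have h := add_e_mem_sq_zero_of_shift_mem_image_of_injOn_tcube c' hinj hx' hmem
  rwa [add_right_comm] at h

omit [NeZero N] in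
/-- ★ Forward unit steps seen on the torus lift into the top box `□ᶻ` (non-wrapping of `□₀`). [cite: Balaban1985RegularSpaces, p.98; Balaban1987RG1, (0.1) p.251, (0.3) p.252] -/
theorem CubeB8DZ.add_e_mem_boxZ_of_shift_mem_image (hinj : Set.InjOn (cover P) (cube P.L c.a c.M c.ρ c.k 0)) {x : Pt P.d} (hx : x ∈ boxZ P.L c.a c.M c.k) {μ : Fin P.d}
    (h : (cover P (x + fun _ => (ctrShift P.L c.k : ℤ))).shift μ ∈ (fun x => cover P (x + fun _ => (ctrShift P.L c.k : ℤ))) '' boxZ P.L c.a c.M c.k) :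
    x + e μ ∈ boxZ P.L c.a c.M c.k := by
  set c' : CubeB8 P.d P.L c.k (fun _ => (Set.univ : Set (B7Prop1Explicit.Site P.d))) :=
    CubeB8.ofUniv c.k c.a c.M c.ρ c.one_le_k le_rfl c.L_le_ρ c.ρ_le_M c.big c.L_le_dM rfl rfl with hc'
  have h0' : c'.sq 0 = cube P.L c.a c.M c.ρ c.k 0 := B8Eq131CubesAdmissible.cubeFam_false_zero P.L c.a c.M c.ρ c.k
  have hinj0 : Set.InjOn (cover P) (c'.sq 0) := by rw [h0']; exact hinj
  rw [mem_boxZ_iff_add_ctrShift]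
  have hx' := (mem_boxZ_iff_add_ctrShift P.L c.a c.M c.k x).1 hx
  obtain ⟨x₁, hx₁, hc₁⟩ := h
  have hmem : (cover P (x + fun _ => (ctrShift P.L c.k : ℤ))).shift μ ∈ cover P '' box P.L c'.a c'.M c'.k :=
    ⟨x₁ + fun _ => (ctrShift P.L c.k : ℤ), (mem_boxZ_iff_add_ctrShift P.L c.a c.M c.k x₁).1 hx₁, hc₁⟩
  have h := add_e_mem_box_of_shift_mem_image_of_injOn c' hinj0 hx' hmem
  rwa [add_right_comm] at h

omit [NeZero N] in
/-- ★ Backward unit steps seen on the torus lift into the top box `□ᶻ`. [cite: Balaban1985RegularSpaces, p.98; Balaban1987RG1, (0.1) p.251, (0.3) p.252] -/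
theorem CubeB8DZ.sub_e_mem_boxZ_of_unshift_mem_image (hinj : Set.InjOn (cover P) (cube P.L c.a c.M c.ρ c.k 0)) {x : Pt P.d} (hx : x ∈ boxZ P.L c.a c.M c.k) {ν : Fin P.d}
    (h : (cover P (x + fun _ => (ctrShift P.L c.k : ℤ))).unshift ν ∈ (fun x => cover P (x + fun _ => (ctrShift P.L c.k : ℤ))) '' boxZ P.L c.a c.M c.k) :
    x - e ν ∈ boxZ P.L c.a c.M c.k := by
  set c' : CubeB8 P.d P.L c.k (fun _ => (Set.univ : Set (B7Prop1Explicit.Site P.d))) :=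
    CubeB8.ofUniv c.k c.a c.M c.ρ c.one_le_k le_rfl c.L_le_ρ c.ρ_le_M c.big c.L_le_dM rfl rfl with hc'
  have h0' : c'.sq 0 = cube P.L c.a c.M c.ρ c.k 0 := B8Eq131CubesAdmissible.cubeFam_false_zero P.L c.a c.M c.ρ c.k
  have hinj0 : Set.InjOn (cover P) (c'.sq 0) := by rw [h0']; exact hinj
  rw [mem_boxZ_iff_add_ctrShift]
  have hx' := (mem_boxZ_iff_add_ctrShift P.L c.a c.M c.k x).1 hx
  obtain ⟨x₁, hx₁, hc₁⟩ := h
  have hmem : (cover P (x + fun _ => (ctrShift P.L c.k : ℤ))).unshift ν ∈ cover P '' box P.L c'.a c'.M c'.k :=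
    ⟨x₁ + fun _ => (ctrShift P.L c.k : ℤ), (mem_boxZ_iff_add_ctrShift P.L c.a c.M c.k x₁).1 hx₁, hc₁⟩
  have h := sub_e_mem_box_of_unshift_mem_image_of_injOn c' hinj0 hx' hmem
  rw [sub_add_eq_add_sub]; exact h

omit [NeZero N] in
/-- `Ω′_j ⊆ Ω′₀ = □₀` for `j ≤ k` (the dented record tower is nested; odd `L`). [cite: Balaban1985Variational, (148)–(150) p.301; Balaban1985RegularSpaces, (1.131) p.99] -/
theorem CubeB8DZ.sq_subset_sq_zero {j : ℕ} (hj : j ≤ c.k) : c.sq j ⊆ c.sq 0 :=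
  (c.sq_subset_cube hj).trans (by rw [c.sq_zero]; exact B8Eq131CubesRec.cube_anti P.hL.1 (Nat.zero_le j) hj)

end Windows

/-! ## §1  The door at the canonical windows -/

section Member

/-- ★★★ **THE (152)+(153) TOWER DOOR FOR THE RECORD, MEMBER GAUGE EXPORTED** — this lineage's g8 `exists_localGauge152_tower_member` for a DENTED record datum `c : CubeB8DZ` and the
TOP-ANCHORED lift `V x μ = ιSU (U ⟨π(x + c_k·𝟙), μ⟩)`: from the `SU(N)`-valued ∃-body of the RECORD crown `GaugedBoundB8DZ L η_n V c r` (R6's conclusion, HYPOTHESIS here), the non-wrapping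
`InjOn π □̃` and `4·(N r) < 2π`: a torus gauge `u : GaugeTransf P 0 (SU N)`, a potential `A` and the member witness `u_m` with the gauge equation on `π(□₀)`, the level-weighted (152) letters
on `Ω′_j` (record coordinates), the four top letters on `π(□)` at the dent's level (`2rL ∕ 2rL² ∕ 2rL³ ∕ 2rL³`), the (153)-gauged lift `A ∘ (x ↦ π(x + c_k·𝟙)) = logCfg η_n (U″^{u_m⁻¹})` on `□̃ᶻ`
with the RECORD's `IsLandau138Z`, ★ `ιSU (u (π(x + c_k·𝟙))) = (u_m x)⁻¹·v_fix x` on `□₀ᶻ`, `u_m ∈ SU(N)`, `u_m = 1` off `□₀ᶻ`, ★ the RECORD's (1.29) `Restr129Z L k Λ′ 1 u_m`, the RECORD's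
(1.137) — the rows of N07's `NrmOfRecordWide` ∕ `NrmSymOfRecord` under this lineage's g9 bridges.
[cite: Balaban1985RegularSpaces, Prop. 6 (1.135)–(1.138) p.99, (1.29) p.81, (1.131) p.99, p.98, p.76; Balaban1985Variational, (144) p.300, (152)–(153) p.301; Balaban1985Averaging, (78)–(81) p.30; Balaban1987RG1, (0.1) p.251, (0.3)–(0.4) pp.252–253] -/
theorem exists_localGauge152_recTower_member (hd : 2 ≤ P.d) {K' : ℕ} {Ω' : ℕ → Set (B7Prop1Explicit.Site P.d)} (c : CubeB8DZ P.d P.L K' Ω')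
    (U : GaugeField P 0 (SU N)) {n : ℕ} (hk : c.k = n) {r : ℝ} (hr : 0 ≤ r)
    (hG : letI : CStarAlgebra (MatA N) := {};
      ∃ u : B7Prop1Explicit.Site P.d → (MatA N)ˣ, (∀ x, u x ∈ specialUnitaryUnits (Fin N)) ∧ (∀ x, x ∉ c.sq 0 → u x = 1) ∧
        Restr129Z P.L c.k c.lamS (1 : B7Prop1Explicit.Site P.d → Fin P.d → (MatA N)ˣ) u ∧
        IsLandau138WZ P.L c.k (P.eta n) (c.sq 0) c.lamS (1 : B7Prop1Explicit.Site P.d → Fin P.d → (MatA N)ˣ)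
          (c.fixed (fun x μ => ιSU N (U ⟨cover P (x + fun _ => (ctrShift P.L c.k : ℤ)), μ⟩)) u) ∧
        (∀ j, j ≤ c.k → ∀ b ∈ {b : B7Prop1Explicit.Site P.d × Fin P.d | SideTouches (c.sq j) b.1 b.2},
          c.fixed (fun x μ => ιSU N (U ⟨cover P (x + fun _ => (ctrShift P.L c.k : ℤ)), μ⟩)) u b.1 b.2 =
              cfgExp (P.eta n) (logCfg (P.eta n) (c.fixed (fun x μ => ιSU N (U ⟨cover P (x + fun _ => (ctrShift P.L c.k : ℤ)), μ⟩)) u)) b.1 b.2 ∧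
            IsSelfAdjoint (logCfg (P.eta n) (c.fixed (fun x μ => ιSU N (U ⟨cover P (x + fun _ => (ctrShift P.L c.k : ℤ)), μ⟩)) u) b.1 b.2) ∧
            ‖logCfg (P.eta n) (c.fixed (fun x μ => ιSU N (U ⟨cover P (x + fun _ => (ctrShift P.L c.k : ℤ)), μ⟩)) u) b.1 b.2‖ ≤ r * ((P.L : ℝ) ^ j * P.eta n)⁻¹) ∧
        (∀ x, ((c.vfix (fun x μ => ιSU N (U ⟨cover P (x + fun _ => (ctrShift P.L c.k : ℤ)), μ⟩)))⁻¹ * u) x ∈ specialUnitaryUnits (Fin N)) ∧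
        AgreeOn (B8Ineq130Rec.tlo P.L (tLo c.a c.ρ) c.k) (B8Ineq130Rec.thi P.L (tHi c.a c.M c.ρ) c.k)
          (gaugeAct ((c.vfix (fun x μ => ιSU N (U ⟨cover P (x + fun _ => (ctrShift P.L c.k : ℤ)), μ⟩)))⁻¹ * u)⁻¹
            (fun x μ => ιSU N (U ⟨cover P (x + fun _ => (ctrShift P.L c.k : ℤ)), μ⟩)))
          (c.fixed (fun x μ => ιSU N (U ⟨cover P (x + fun _ => (ctrShift P.L c.k : ℤ)), μ⟩)) u) ∧
        msup P.L c.k (P.eta n) (-(2 : ℝ)) (fun j (q : Fin P.d × Fin P.d × B7Prop1Explicit.Site P.d) => SideTouches (c.sq j) q.2.2 q.2.1)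
            (fun q => covDerivFwd (P.eta n) (1 : B7Prop1Explicit.Site P.d → Fin P.d → (MatA N)ˣ) q.1
              (fun z => c.expo (P.eta n) (fun x μ => ιSU N (U ⟨cover P (x + fun _ => (ctrShift P.L c.k : ℤ)), μ⟩)) u z q.2.1) q.2.2) ≤ r ∧
        bondNorm P.L c.k (P.eta n) (-(3 : ℝ)) c.sq
            (fun x μ => pdiv (P.eta n) (1 : B7Prop1Explicit.Site P.d → Fin P.d → (MatA N)ˣ)
              (plaqCovDeriv (P.eta n) (1 : B7Prop1Explicit.Site P.d → Fin P.d → (MatA N)ˣ)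
                (c.expo (P.eta n) (fun x μ => ιSU N (U ⟨cover P (x + fun _ => (ctrShift P.L c.k : ℤ)), μ⟩)) u)) μ x) ≤ r ∧
        bondNorm P.L c.k (P.eta n) (-(3 : ℝ)) c.sq
            (fun x μ => covLap (P.eta n) (1 : B7Prop1Explicit.Site P.d → Fin P.d → (MatA N)ˣ)
              (fun z => c.expo (P.eta n) (fun x μ => ιSU N (U ⟨cover P (x + fun _ => (ctrShift P.L c.k : ℤ)), μ⟩)) u z μ) x) ≤ r ∧
        (∀ (x : B7Prop1Explicit.Site P.d) (μ : Fin P.d), bLoZ P.L c.a 0 0 ≤ x → x + e μ ≤ bHiZ P.L c.a c.M 0 0 → c.inTop x → c.inTop (x + e μ) →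
          logCovIterZ P.L (1 : B7Prop1Explicit.Site P.d → Fin P.d → (MatA N)ˣ)
              (iEta (P.eta n) (c.expo (P.eta n) (fun x μ => ιSU N (U ⟨cover P (x + fun _ => (ctrShift P.L c.k : ℤ)), μ⟩)) u)) c.k x μ =
            mlog ((avgIterZ P.L (c.axial (fun x μ => ιSU N (U ⟨cover P (x + fun _ => (ctrShift P.L c.k : ℤ)), μ⟩))) c.k x μ : (MatA N)ˣ) : MatA N)))
    (hinj : Set.InjOn (cover P) (tcube P.L c.a c.M c.ρ c.k)) (h4 : 4 * ((N : ℝ) * r) < 2 * Real.pi) :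
    letI : CStarAlgebra (MatA N) := {}
    ∃ u : GaugeTransf P 0 (SU N), ∃ A : PBond P 0 → MatA N, ∃ um : B7Prop1Explicit.Site P.d → (MatA N)ˣ,
      (∀ b ∈ (Sect2.regionOfSet P (cover P '' cube P.L c.a c.M c.ρ c.k 0)).bonds, gaugeU (fun x => ιSU N (u x)) (fun b' => ιSU N (U b')) b = expI (P.eta n) (A b)) ∧
      (∀ j, j ≤ c.k → ∀ (x : Pt P.d) (μ : Fin P.d), x ∈ c.sq j → x + e μ ∈ c.sq j →
          ‖A ⟨cover P (x + fun _ => (ctrShift P.L c.k : ℤ)), μ⟩‖ ≤ 2 * (r * ((P.L : ℝ) ^ j * P.eta n)⁻¹)) ∧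
      (∀ b ∈ (Sect2.regionOfSet P (cover P '' box P.L c.a c.M c.k)).bonds, ‖A b‖ ≤ 2 * (r * P.L)) ∧
      (∀ q ∈ (Sect2.regionOfSet P (cover P '' box P.L c.a c.M c.k)).dpairs, ‖grad (P.eta n) q.2.1 (fun y => A ⟨y, q.2.2⟩) q.1‖ ≤ 2 * (r * (P.L : ℝ) ^ 2)) ∧
      (∀ b ∈ Sect2.bondsDeep (cover P '' box P.L c.a c.M c.k), ‖Sect2.codiffCurlA (P.eta n) A b.src b.dir‖ ≤ 2 * (r * (P.L : ℝ) ^ 3)) ∧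
      (∀ b ∈ Sect2.bondsDeep (cover P '' box P.L c.a c.M c.k),
          ‖∑ ν : Fin P.d, ((P.eta n : ℝ) : ℂ)⁻¹ •
              (grad (P.eta n) ν (fun y => A ⟨y, b.dir⟩) (b.src.unshift ν) - grad (P.eta n) ν (fun y => A ⟨y, b.dir⟩) b.src)‖ ≤ 2 * (r * (P.L : ℝ) ^ 3)) ∧
      (∀ x, x ∈ tcubeZ P.L c.a c.M c.ρ c.k → ∀ μ,
          A ⟨cover P (x + fun _ => (ctrShift P.L c.k : ℤ)), μ⟩ = logCfg (P.eta n) (c.fixed (fun x μ => ιSU N (U ⟨cover P (x + fun _ => (ctrShift P.L c.k : ℤ)), μ⟩)) um) x μ) ∧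
      IsLandau138Z P.L c.k (P.eta n) (c.sq 0) c.lamS (1 : B7Prop1Explicit.Site P.d → Fin P.d → (MatA N)ˣ)
        (logCfg (P.eta n) (c.fixed (fun x μ => ιSU N (U ⟨cover P (x + fun _ => (ctrShift P.L c.k : ℤ)), μ⟩)) um)) ∧
      (∀ x, x ∈ c.sq 0 →
          ιSU N (u (cover P (x + fun _ => (ctrShift P.L c.k : ℤ)))) = (um x)⁻¹ * c.vfix (fun x μ => ιSU N (U ⟨cover P (x + fun _ => (ctrShift P.L c.k : ℤ)), μ⟩)) x) ∧
      (∀ x, um x ∈ specialUnitaryUnits (Fin N)) ∧ (∀ x, x ∉ c.sq 0 → um x = 1) ∧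
      Restr129Z P.L c.k c.lamS (1 : B7Prop1Explicit.Site P.d → Fin P.d → (MatA N)ˣ) um ∧
      (∀ (x : B7Prop1Explicit.Site P.d) (μ : Fin P.d), bLoZ P.L c.a 0 0 ≤ x → x + e μ ≤ bHiZ P.L c.a c.M 0 0 → c.inTop x → c.inTop (x + e μ) →
        logCovIterZ P.L (1 : B7Prop1Explicit.Site P.d → Fin P.d → (MatA N)ˣ)
            (iEta (P.eta n) (c.expo (P.eta n) (fun x μ => ιSU N (U ⟨cover P (x + fun _ => (ctrShift P.L c.k : ℤ)), μ⟩)) um)) c.k x μ =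
          mlog ((avgIterZ P.L (c.axial (fun x μ => ιSU N (U ⟨cover P (x + fun _ => (ctrShift P.L c.k : ℤ)), μ⟩))) c.k x μ : (MatA N)ˣ) : MatA N)) := by
  letI : CStarAlgebra (MatA N) := {}
  have hLo : Odd P.L := P.hL.1
  have hL : 2 ≤ P.L := P.hL.2
  have hρ1 : 1 ≤ c.ρ := le_trans (le_trans (by norm_num) hL) c.L_le_ρ
  -- the canonical windows `X := Ω′₀ = □₀ᶻ`, `X_t := □ᶻ`, `X′ := □̃ᶻ`
  have hXX' : c.sq 0 ⊆ tcubeZ P.L c.a c.M c.ρ c.k := CubeB8DZ.sq_zero_subset_tcube hLo hL c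
  have hXt : boxZ P.L c.a c.M c.k ⊆ c.sq 0 := by
    rw [c.sq_zero]; exact B8Eq131CubesRec.box_subset_cube hLo (Nat.zero_le _)
  have hbox : boxZ P.L c.a c.M c.k ⊆ cubeZ P.L c.a c.M c.ρ c.k c.k := B8Eq131CubesRec.box_subset_cube_top hLo c.a c.M c.ρ c.k
  have hinj' := injOn_coverShift_tcubeZ (P := P) (k := c.k) hinj
  have hinj0 : Set.InjOn (cover P) (cube P.L c.a c.M c.ρ c.k 0) := hinj.mono (B8Eq131Cubes.cube_subset_tcube hL hρ1 (Nat.zero_le _))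
  obtain ⟨u, A, um, h1, hlev, h2, h3, h4c, h4', hA7, h5, hsid, hsu, hoff, h129, h137⟩ :=
    exists_localGauge152_recTower_window_member hd c U (fun _ => (ctrShift P.L c.k : ℤ)) hk hr hG hXX' hXt hXX' hinj'
      (fun x hx μ h => c.add_e_mem_sq_zero_of_shift_mem_image hinj hx h)
      (fun x hx μ h => c.add_e_mem_boxZ_of_shift_mem_image hinj0 hx h)
      (fun x hx ν h => c.sub_e_mem_boxZ_of_unshift_mem_image hinj0 hx h) subset_rfl hbox h4
  have himg0 : (fun x => cover P (x + fun _ => (ctrShift P.L c.k : ℤ))) '' c.sq 0 = cover P '' cube P.L c.a c.M c.ρ c.k 0 := by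
    rw [c.sq_zero]; exact image_coverShift_cubeZ c.a c.M c.ρ (Nat.zero_le _)
  have himgt : (fun x => cover P (x + fun _ => (ctrShift P.L c.k : ℤ))) '' boxZ P.L c.a c.M c.k = cover P '' box P.L c.a c.M c.k :=
    image_coverShift_boxZ c.a c.M c.k
  rw [himg0] at h1
  rw [himgt] at h2 h3 h4c h4'
  exact ⟨u, A, um, h1, fun j hj x μ hxj hxj' => hlev j hj x μ (c.sq_subset_sq_zero hj hxj) (c.sq_subset_sq_zero hj hxj') hxj hxj',
    h2, h3, h4c, h4', hA7, h5, hsid, hsu, hoff, h129, h137⟩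

end Member

end Literature.MathematicalPhysics.QuantumFieldTheory.Balaban1983to89.Node00

end

/-! ## Axiom audit (gate whitelist: `propext`, `Classical.choice`, `Quot.sound`) -/
#print axioms Literature.MathematicalPhysics.QuantumFieldTheory.Balaban1983to89.Node00.exists_localGauge152_recTower_member
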